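import Literature.MathematicalPhysics.QuantumFieldTheory.Balaban1983to89.B2Eq245KernelField

/-!
# `Balaban1983to89.B2Eq245TowerData` — T. Bałaban, *(Higgs)₂,₃ quantum fields in a finite volume. II. An upper bound*,
Commun. Math. Phys. **86** (1982) 555–594 [Balaban1982Higgs2] p. 567 [PDF 13]: the DATA of the displays **(2.45)/(2.46)**
(`B2Eq245Assembled.Data245`: the regions `Λ₅^{(k−1)}`, `Λ₃^{(k−1)}`, `Λ₄^{(k−1)}`, `Λ₆^{(k−2)′}`, `B^{k−1}(Λ₂^{(k−1)})`,
`B^{k−1}(Λ₂^{(k−2)′}∩Λ₅^{(k−1)c})` and the kernel's field `Ã`) INSTANTIATED FROM THE TREE'S CONSTRUCTIONS — the regions of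
the constructed tower `B2Eq243RegionsTower.towerRegion` (built from the large-field points of every step), the cut-offs `θ_k`
of `B2Eq245Theta.thetaOf`, the kernel field `B2Eq245KernelField.atilde` — with the GEOMETRIC half of the hypothesis bundle
`Data245.Hyp` (the nestings `Λ₅ ⊂ Λ₃`, `Λ₅ ⊂ Λ₄`, `Λ₅^{(k−1)} ⊂ Λ₆^{(k−2)′}` and the agreement `Ã = A^{(k),ε}` under `Λ₅`)
PROVED, so that **(2.45) = (2.46) (`B2Eq245Assembled.display245_eq_display246`) holds for Bałaban's own regions and cut-offs**
given only the analytic hypotheses on the four characteristic functions and `ρ′^{(k−1)}`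

statement-level skeleton of published theorems with citation tags; proofs where landed; nothing here is a claim about the Yang–Mills mass gap

PDF held: `paper:balaban1982-cmp86-higgs23-ii` (journal page = PDF page + 554); pp. 566–567 [PDF 12–13] read AS IMAGES on the
×2 renders `run/shared/lean/pub/pub-balaban/b2b-balaban-ref1/pages/1982-cmp86-higgs23-II/1982-cmp86-higgs23-II-p012-x2.png`,
`-p013-x2.png`; p. 558 [PDF 4] ((2.7)–(2.8)), p. 570 [PDF 16], p. 588 [PDF 34] through the cited tree files.

CITATION HEADER (lean-in-tree rule).  lit-balaban typed skeleton (HOME `run/shared/lean/pub/lit-balaban/`), reader/typer and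
fold-owner line r02 (unit `lit-balaban-r02`, gen 53); SKELETON row **B2.Eq2.44** ((2.44)–(2.52), pp. 566–569, owner r02, second
reader r14), a member of zero head weight after `B2Eq246MaskedStep` (p368929), `B2Eq245Assembled` (p369272/p373811) and
`B2Eq245KernelField` (p370387): item (a) of `B2Eq245Assembled`'s HONEST SCOPE — *"the tree has the constructions
`B2Eq28RegionsConcrete`/`B2Eq243RegionsTower`, `B2Eq244Cutoff`, `B2Eq245Theta`, …; instantiating `Data245` with them and
discharging `Hyp` … is bookkeeping left to the consumer"* — done here for the regions and the kernel field.  NOTHING of record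
is restated: the regions ARE the typer's `towerRegion bad (towerRad Q P) j i` (gen 9, p269146) with its nesting theorems
`towerRegion_antitone` ((2.8)′ within a step) and `towerRegion_succ_subset_prime` (p. 566 *"In general Λ₀^{(j+1)} ⊂ Λ₇^{(j)′}"*),
`Λ′` IS p15's `B2Eq324NestedRegions.prime` (monotone: p23's `B2Eq28RegionsCollars.prime_mono`), `B^{k−1}(·)` IS `B2Eq255Concrete.underRegion`, `B(·)` IS `HiggsLattice.blockSet`,
the radii ARE `B2Prop31MinimizerRegions.towerRad` (= `r(Lʲε)`), the cut-offs ARE p23's `B2Eq245Theta.thetaOf` (p321142), `Ã` IS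
g52's `B2Eq245KernelField.atilde` with its agreement theorem `atil_thetaOf`, the displays and the theorem ARE
`B2Eq245Assembled.display245`/`display246`/`display245_eq_display246`, all BY NAME.

THE SOURCE TEXT.  p. 567 [PDF 13]: (2.45)/(2.46) verbatim in the header of `B2Eq245Assembled`; *"where Ã = (1 − θ_k)θ_{k−1}A^{(k−1),ε}
+ θ_kA^{(k),ε}, and the characteristic functions χ_k, ζ_{Λ₀^{(k−1)}}, etc. are defined analogously to the corresponding functions
in Sect. A, with ε replaced by L^{k−1}ε and Λ₀ by Λ₀^{(k−1)}. Another representation is obtained by calculation of a conditional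
integral in (2.45) with the conditioning on Λ₅^{(k−1)c}"*; pp. 566–567: *"The function θ_k is defined on T_η, is equal to 1 on
B^{k−1}(Λ₂^{(k−1)}) and varies “smoothly” from 1 to 0 on a slice of thickness < M surrounding B^{k−1}(Λ₂^{(k−1)})"*; p. 566
[PDF 12]: *"The sets are unions of big blocks … In general Λ₀^{(j+1)} ⊂ Λ₇^{(j)′} … Of course the sets Λ_i^{(j)} are defined in the
same way as Λ_i, r(ε) is replaced by r(Lʲε) only. Finally let us notice that Λ_i^{(j)} does not mean the prime operation applied
j times to a set Λ_i, for different j these are independent sets"*, *"We will use the same notations for the sets in different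
scales"*; p. 558 (2.8): *"Λ₅ ⊂ Λ₄ ⊂ Λ₃ ⊂ …"* (the regions of one step are nested, each at distance `r` from the next).

DICTIONARY (print ↦ Lean; the level index of `Data245` is `k − 1`, here `k − 1 = j + 1`, so `k ≥ 2` — (2.45) generalizes the
first step (2.34)–(2.42)).  `Λ_i^{(k−1)}` ↦ `towerRegion bad (towerRad Q P) (j+1) i`; `Λ′₅` (the block points of `Λ₅^{(k−1)}`,
`Λ₅ = B(Λ′₅)`) ↦ `prime (towerRegion … (j+1) 5)` (`blockSet_prime_towerRegion`: `B(Λ′₅) = Λ₅` because the region is a union of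
blocks); `Λ₆^{(k−2)′}` ↦ `prime (towerRegion … j 6)`; `B^{k−1}(Λ₂^{(k−1)})` ↦ `underRegion (j+1) (towerRegion … (j+1) 2)`;
`B^{k−1}(Λ₂^{(k−2)′} ∩ Λ₅^{(k−1)c})` ↦ `underRegion (j+1) (prime (towerRegion … j 2) ∩ (towerRegion … (j+1) 5)ᶜ)`; `θ_k`, `θ_{k−1}` ↦
`thetaOf Q P bad K (j+2)`, `thetaOf Q P bad K (j+1)`; `Ã` ↦ `atilde θ_k θ_{k−1} A^{(k−1),ε} A^{(k),ε}`.  What stays DATA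
(`Weights`): the fields `A^{(k),ε}` ((2.44), a function of the new field `A`; the tree's `B2StepK.bg244`/`B2Eq244Cutoff` at the
caller's choice), `A^{(k−1),ε}` (inside `Ã`; a function of `A′`, frozen as in `B2Eq245Assembled` HONEST SCOPE (b)), `Ã′`, and the
weights `χ_k`, `ζ_{Λ₀^{(k−1)}}`, `χ_{Λ₋₁^{(k−1)}∩Λ₅^{(k−1)c}}`, `χ_{k−1,Λ₅^{(k−1)c}}`, `ρ′^{(k−1)}` with their ANALYTIC hypotheses
(`Weights.Hyp`: locality in `Λ₅^{(k−1)c}`, nonnegativity, measurability — (2.4)–(2.6)′, (2.15)′, (2.49)–(2.50)).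

WHAT IS PROVED (kernel-checked, 0 `sorry`, standard axioms; definitions WITH BODY + theorems; NO `Prop`-valued fact — `Weights.Hyp`
is a `structure … : Prop` consumed as a hypothesis, never asserted, exactly the analytic half of `Data245.Hyp`).
 §1 geometry (`prime_mono` is p23's `B2Eq28RegionsCollars.prime_mono`, BY NAME): `blockSet_prime_eq` (`B(Λ′) = Λ` for a union of blocks), **`blockSet_prime_towerRegion`**,
    `towerRegion_succ_subset_prime_of_le` (`Λ_i^{(j+1)} ⊂ Λ_{i′}^{(j)′}` for `i′ ≤ 7`).
 §2 `Weights` (the remaining data) and **`dataOfTower`** (the `Data245` of the constructed tower) with its `rfl` dictionary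
    (`dataOfTower_L5` … `dataOfTower_Atil`), `blockSet_dataOfTower_L5` (`B(Λ′₅) = Λ₅^{(k−1)}`), `blockSet_dataOfTower_L5_eq_towerOf_lam`
    (= the level `k − 1` of the §3 tower of record `towerOf`), `mem_dataOfTower_B2`/`mem_dataOfTower_B2p`.
 §3 `Weights.Hyp` and **`hyp_dataOfTower`**: `Data245.Hyp` for the constructed data — `L5_R3`/`L5_R4` from `towerRegion_antitone`,
    `L5_R6` from `towerRegion_succ_subset_prime` + `prime_mono`, `atil` from `B2Eq245KernelField.atil_thetaOf` (`Λ₅ ⊂ Λ₂`).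
 §4 **`display245_eq_display246_tower`**: (2.45) = (2.46) for Bałaban's regions and cut-offs at every step `k = j + 2 ≤ K`, every
    large-field data `bad`, every weights satisfying `Weights.Hyp`.
 §5 non-vacuity: `Weights.const` (all characteristic functions and `ρ′` ≡ 1) satisfies `Weights.Hyp` (`const_hyp`), hence
    `exists_hyp_dataOfTower`; with no large field every region is the whole lattice (`dataOfTower_L5_of_no_bad`).
HONEST SCOPE.  (a) The large-field points `bad j` of every step are data (the characteristic functions decide them —
`B2Eq243RegionsTower` HONEST SCOPE (a)); (b) the four characteristic functions and `ρ′^{(k−1)}` stay data with hypotheses (print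
constructs them in (2.4)–(2.6)′/(2.15)′ and inductively in (2.47)–(2.50); the tree's `B2Eq22LargeFieldSets`/`B2Eq29DictionaryConcrete`/
`B2Sect2BDensities` are not threaded here); (c) `A^{(k),ε}`, `A^{(k−1),ε}`, `Ã′` are field PARAMETERS (the identity (2.45) = (2.46)
holds for every choice; print's are (2.44) and p. 569); (d) the cut-offs enter `Ã` evaluated at the source of a bond
(`B2Eq245KernelField` HONEST SCOPE (a)); (e) thresholds `≥ r` as in the region files; `R, r ≥ 0` of `Q`; `k = j + 2 ≤ K` and `k ≤`
the lattice depth `P.K`; m² > 0, μ₀² > 0, a > 0, L > 1 as in `display245_eq_display246`; (f) nothing quantitative and no convergence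
statement (Bochner convention of `B2Eq245Assembled` HONEST SCOPE (d)).  Value = the (2.45) = (2.46) theorem of record tied to the
constructed region tower and cut-offs, its geometric hypotheses discharged; NOT summit progress.  Unit `lit-balaban-r02` gen 53
(literature-prover-lit-balaban-r02-g53-0); HOME/FILED.md records the proposal (first filing p374410 bounced `dedup.landed` on a
copy of `prime_mono` only — copy deleted, the landed lemma opened by name; nothing else changed).
-/

open scoped BigOperators
open _root_.MeasureTheory

namespace Literature.MathematicalPhysics.QuantumFieldTheory.Balaban1983to89.B2Eq245TowerData

open HiggsLattice HiggsAveraging B2Eq255Concrete B2Eq245Assembled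
open B2Eq243RegionsTower (towerRegion towerRegion_antitone towerRegion_blockOf_congr towerRegion_succ_subset_prime
  towerRegion_eq_univ_of_no_bad prime_univ)
open B2Prop31MinimizerRegions (towerRad towerRad_nonneg)
open B2Eq324NestedRegions (prime mem_prime)
open B2Eq245Theta (thetaOf)
open B2Eq245KernelField (atilde atil_thetaOf)
open B2Eq28RegionsCollars (prime_mono)

variable {P : HiggsLattice.Params} {N : ℕ}

/-! ## §1 Geometry of the constructed regions: `Λ′`, `B(Λ′) = Λ`, the cross-level nesting -/

section Geometry

/-- **`B(Λ′) = Λ` for a union of blocks `Λ`** (p. 566 *"The sets are unions of big blocks"*; `y ∈ Λ′ ⇔ B(y) ⊂ Λ`).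
[cite: Balaban1982Higgs2, (2.43) p.566] -/
theorem blockSet_prime_eq {k : ℕ} {Λ : Finset (HiggsLattice.Site P k)}
    (hU : ∀ x x' : HiggsLattice.Site P k, HiggsLattice.blockOf x = HiggsLattice.blockOf x' → (x ∈ Λ ↔ x' ∈ Λ)) :
    HiggsLattice.blockSet (prime Λ) = Λ := by
  ext x
  rw [HiggsLattice.mem_blockSet, mem_prime]
  exact ⟨fun h => h x rfl, fun h x' hx' => (hU x' x hx').mpr h⟩

/-- **`B(Λ_i^{(j)′}) = Λ_i^{(j)}`** for every region of the constructed tower (each is a union of blocks,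
`towerRegion_blockOf_congr`). [cite: Balaban1982Higgs2, (2.43) p.566] -/
theorem blockSet_prime_towerRegion (bad : (j : ℕ) → Set (HiggsLattice.Site P j)) (r : ℕ → ℝ) (j i : ℕ) :
    HiggsLattice.blockSet (prime (towerRegion bad r j i)) = towerRegion bad r j i :=
  blockSet_prime_eq fun _ _ h => towerRegion_blockOf_congr j i h

/-- **`Λ_i^{(j+1)} ⊂ Λ_{i′}^{(j)′}` for `i′ ≤ 7`** (p. 566 *"In general Λ₀^{(j+1)} ⊂ Λ₇^{(j)′}"* and the nesting (2.8)′ of step `j`: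
`Λ₇^{(j)} ⊂ Λ_{i′}^{(j)}`). [cite: Balaban1982Higgs2, (2.43) p.566] -/
theorem towerRegion_succ_subset_prime_of_le {bad : (j : ℕ) → Set (HiggsLattice.Site P j)} {r : ℕ → ℝ} {j : ℕ}
    (hr : 0 ≤ r j) (hr' : 0 ≤ r (j + 1)) (i : ℕ) {i' : ℕ} (hi' : i' ≤ 7) :
    towerRegion bad r (j + 1) i ⊆ prime (towerRegion bad r j i') :=
  (towerRegion_succ_subset_prime hr' i).trans (prime_mono (towerRegion_antitone hr hi'))

end Geometry

/-! ## §2 The remaining data, and the `Data245` of the constructed tower -/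

section Data

variable (P N) in
/-- **What stays DATA in (2.45)/(2.46) once the regions and the cut-offs are the constructed ones** (level `j` = print's
`k − 1`): the external fields `A^{(k),ε}` ((2.44); the form's and the covariance's field), `A^{(k−1),ε}` (entering the kernel's
field `Ã = (1 − θ_k)θ_{k−1}A^{(k−1),ε} + θ_kA^{(k),ε}`), `Ã′` (the field of `ρ′^{(k−1)}`, p. 569), and the weights `χ_k`,
`ζ_{Λ₀^{(k−1)}}`, `χ_{Λ₋₁^{(k−1)}∩Λ₅^{(k−1)c}}`, `χ_{k−1,Λ₅^{(k−1)c}}` (*"defined analogously to the corresponding functions in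
Sect. A"*) and `ρ′^{(k−1),L^{k−1}ε}(Λ₀^{(0)}, …, Λ₀^{(k−2)}, A′, Ã′, φ′)`, in the letters of `B2Eq245Assembled.Data245`.
[cite: Balaban1982Higgs2, (2.45)–(2.46) p.567] -/
structure Weights (j : ℕ) where
  /-- `A^{(k),ε}` ((2.44)). [cite: Balaban1982Higgs2, (2.44) p.566] -/
  Ak : HiggsLattice.VecField P 0
  /-- `A^{(k−1),ε}` (inside `Ã`). [cite: Balaban1982Higgs2, (2.45) p.567] -/
  Akm1 : HiggsLattice.VecField P 0
  /-- `Ã′` (p. 569). [cite: Balaban1982Higgs2, (2.51) p.569] -/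
  Atil' : HiggsLattice.VecField P 0
  /-- `χ_k`, a function of the new fields `(A, φ)`. [cite: Balaban1982Higgs2, (2.45) p.567] -/
  chik : ScalarField P (j + 1) P.d → ScalarField P (j + 1) N → ℝ
  /-- `ζ_{Λ₀^{(k−1)}}` ((2.15)′), a function of `(A, φ, A′, φ′)`. [cite: Balaban1982Higgs2, (2.45) p.567] -/
  zeta : ScalarField P (j + 1) P.d → ScalarField P (j + 1) N → ScalarField P j P.d → ScalarField P j N → ℝ
  /-- `χ_{Λ₋₁^{(k−1)}∩Λ₅^{(k−1)c}}`. [cite: Balaban1982Higgs2, (2.45) p.567] -/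
  chi1 : ScalarField P (j + 1) P.d → ScalarField P (j + 1) N → ScalarField P j P.d → ScalarField P j N → ℝ
  /-- `χ_{k−1,Λ₅^{(k−1)c}}`. [cite: Balaban1982Higgs2, (2.45) p.567] -/
  chi2 : ScalarField P (j + 1) P.d → ScalarField P (j + 1) N → ScalarField P j P.d → ScalarField P j N → ℝ
  /-- `ρ′^{(k−1),L^{k−1}ε}(Λ₀^{(0)}, …, Λ₀^{(k−2)}, A′, Ã′, φ′)` as a function of `(A′, Ã′, φ′)`. [cite: Balaban1982Higgs2, (2.45) p.567] -/
  rhoP : ScalarField P j P.d → HiggsLattice.VecField P 0 → ScalarField P j N → ℝ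

variable (Q : B2.Params) (bad : (j : ℕ) → Set (HiggsLattice.Site P j)) (K : ℕ) (j : ℕ) (W : Weights P N (j + 1))

/-- **THE DATA OF (2.45)/(2.46) FROM THE CONSTRUCTED TOWER** at the step `k = j + 2` (level `k − 1 = j + 1` of `Data245`):
`Λ′₅ := (Λ₅^{(k−1)})′`, `Λ₃^{(k−1)}`, `Λ₄^{(k−1)}`, `Λ₆^{(k−2)′}`, `B^{k−1}(Λ₂^{(k−1)})`, `B^{k−1}(Λ₂^{(k−2)′} ∩ Λ₅^{(k−1)c})` from
`B2Eq243RegionsTower.towerRegion bad (towerRad Q P)` (radius `r(Lʲε)`), the kernel's field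
`Ã = (1 − θ_k)θ_{k−1}A^{(k−1),ε} + θ_kA^{(k),ε}` from the constructed cut-offs `B2Eq245Theta.thetaOf` (`B2Eq245KernelField.atilde`),
the rest from `W`. [cite: Balaban1982Higgs2, (2.45)–(2.46) p.567] -/
noncomputable def dataOfTower : Data245 P N (j + 1) where
  L5 := prime (towerRegion bad (towerRad Q P) (j + 1) 5)
  R3 := towerRegion bad (towerRad Q P) (j + 1) 3
  R4 := towerRegion bad (towerRad Q P) (j + 1) 4
  R6p := prime (towerRegion bad (towerRad Q P) j 6)
  B2 := underRegion (j + 1) (towerRegion bad (towerRad Q P) (j + 1) 2)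
  B2p := underRegion (j + 1) (prime (towerRegion bad (towerRad Q P) j 2) ∩ (towerRegion bad (towerRad Q P) (j + 1) 5)ᶜ)
  Ak := W.Ak
  Atil := atilde (thetaOf Q P bad K (j + 2)) (thetaOf Q P bad K (j + 1)) W.Akm1 W.Ak
  Atil' := W.Atil'
  chik := W.chik
  zeta := W.zeta
  chi1 := W.chi1
  chi2 := W.chi2
  rhoP := W.rhoP

/-- `Λ′₅ = (Λ₅^{(k−1)})′` (definitional). [cite: Balaban1982Higgs2, (2.46) p.567] -/
theorem dataOfTower_L5 : (dataOfTower Q bad K j W).L5 = prime (towerRegion bad (towerRad Q P) (j + 1) 5) := rfl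

/-- `Λ₃ = Λ₃^{(k−1)}` (definitional). [cite: Balaban1982Higgs2, (2.45) p.567] -/
theorem dataOfTower_R3 : (dataOfTower Q bad K j W).R3 = towerRegion bad (towerRad Q P) (j + 1) 3 := rfl

/-- `Λ₄ = Λ₄^{(k−1)}` (definitional). [cite: Balaban1982Higgs2, (2.45) p.567] -/
theorem dataOfTower_R4 : (dataOfTower Q bad K j W).R4 = towerRegion bad (towerRad Q P) (j + 1) 4 := rfl

/-- `Λ₆′ = Λ₆^{(k−2)′}` (definitional). [cite: Balaban1982Higgs2, (2.45) p.567] -/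
theorem dataOfTower_R6p : (dataOfTower Q bad K j W).R6p = prime (towerRegion bad (towerRad Q P) j 6) := rfl

/-- `B2 = B^{k−1}(Λ₂^{(k−1)})` (definitional). [cite: Balaban1982Higgs2, (2.45) p.567] -/
theorem dataOfTower_B2 : (dataOfTower Q bad K j W).B2 = underRegion (j + 1) (towerRegion bad (towerRad Q P) (j + 1) 2) := rfl

/-- `B2p = B^{k−1}(Λ₂^{(k−2)′} ∩ Λ₅^{(k−1)c})` (definitional). [cite: Balaban1982Higgs2, (2.45) p.567] -/
theorem dataOfTower_B2p : (dataOfTower Q bad K j W).B2p =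
    underRegion (j + 1) (prime (towerRegion bad (towerRad Q P) j 2) ∩ (towerRegion bad (towerRad Q P) (j + 1) 5)ᶜ) := rfl

/-- `Ã = (1 − θ_k)θ_{k−1}A^{(k−1),ε} + θ_kA^{(k),ε}` at the constructed cut-offs (definitional). [cite: Balaban1982Higgs2, (2.45) p.567] -/
theorem dataOfTower_Atil : (dataOfTower Q bad K j W).Atil =
    atilde (thetaOf Q P bad K (j + 2)) (thetaOf Q P bad K (j + 1)) W.Akm1 W.Ak := rfl

/-- `A^{(k),ε}` is the datum of `W` (definitional). [cite: Balaban1982Higgs2, (2.44) p.566] -/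
theorem dataOfTower_Ak : (dataOfTower Q bad K j W).Ak = W.Ak := rfl

/-- **The conditioning region is `Λ₅^{(k−1)}` itself**: `B(Λ′₅) = Λ₅^{(k−1)}`. [cite: Balaban1982Higgs2, (2.46) p.567] -/
theorem blockSet_dataOfTower_L5 :
    HiggsLattice.blockSet (dataOfTower Q bad K j W).L5 = towerRegion bad (towerRad Q P) (j + 1) 5 :=
  blockSet_prime_towerRegion bad (towerRad Q P) (j + 1) 5

/-- **The conditioning region of the constructed data IS the level `k − 1` of the §3 tower of record**
`B2Eq243RegionsTower.towerOf` (`Λ₅^{(k−1)} = lam (k − 1)` below `K`; p. 588 (3.22)): the same constructed regions drive (2.45)/(2.46)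
here and (3.22)–(3.28) there (`eq328_constructed`). [cite: Balaban1982Higgs2, (2.46) p.567, (3.22) p.588] -/
theorem blockSet_dataOfTower_L5_eq_towerOf_lam (hR : 0 ≤ Q.R) (hr : 0 ≤ Q.r) (hjK : j + 1 < K) :
    HiggsLattice.blockSet (dataOfTower Q bad K j W).L5 =
      (B2Eq243RegionsTower.towerOf bad (towerRad Q P) (towerRad_nonneg hR hr P) K).lam (j + 1) := by
  rw [blockSet_dataOfTower_L5, B2Eq243RegionsTower.towerOf_lam_of_lt hjK]

/-- `z ∈ B^{k−1}(Λ₂^{(k−1)}) ⇔ z_{k−1} ∈ Λ₂^{(k−1)}` (the Neumann region of the scalar operators of lines 4 and 7–10).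
[cite: Balaban1982Higgs2, (2.45) p.567] -/
theorem mem_dataOfTower_B2 (z : HiggsLattice.Site P 0) :
    z ∈ (dataOfTower Q bad K j W).B2 ↔ blockIter (j + 1) z ∈ towerRegion bad (towerRad Q P) (j + 1) 2 :=
  mem_underRegion _ _ z

/-- `z ∈ B^{k−1}(Λ₂^{(k−2)′} ∩ Λ₅^{(k−1)c}) ⇔ z_{k−1} ∈ Λ₂^{(k−2)′}` and `z_{k−1} ∉ Λ₅^{(k−1)}` (the Neumann region of the middle
operator, lines 2–3 / 5–6). [cite: Balaban1982Higgs2, (2.45) p.567] -/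
theorem mem_dataOfTower_B2p (z : HiggsLattice.Site P 0) :
    z ∈ (dataOfTower Q bad K j W).B2p ↔ blockIter (j + 1) z ∈ prime (towerRegion bad (towerRad Q P) j 2) ∧
      blockIter (j + 1) z ∉ towerRegion bad (towerRad Q P) (j + 1) 5 := by
  rw [dataOfTower_B2p, mem_underRegion, Finset.mem_inter, Finset.mem_compl]

/-- With no large field at any step every region is the whole lattice, so `Λ′₅ = T^{(k)}` (non-vacuity of the geometry;
`towerRegion_eq_univ_of_no_bad`). [cite: Balaban1982Higgs2, (2.43) p.566] -/
theorem dataOfTower_L5_of_no_bad (h : ∀ i, bad i = ∅) : (dataOfTower Q bad K j W).L5 = Finset.univ := by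
  rw [dataOfTower_L5, towerRegion_eq_univ_of_no_bad h, prime_univ]

end Data

/-! ## §3 The analytic hypotheses on the weights, and `Data245.Hyp` for the constructed data -/

section Hyp

variable {j : ℕ}

/-- **The analytic half of `B2Eq245Assembled.Data245.Hyp`**, on the weights alone, relative to a conditioning region `Λ₅`
(a set of sites of the fluctuation lattice): the three characteristic functions and `ρ′^{(k−1)}` depend on the fluctuation fields
`A′, φ′` only outside `Λ₅` (the conditioning *"on Λ₅^{(k−1)c}"*; for `ρ′`: (2.50) at step `k − 1`), are nonnegative and jointly
measurable in `(A′, φ′)`. [cite: Balaban1982Higgs2, (2.45)–(2.46) p.567] -/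
structure Weights.Hyp (W : Weights P N j) (Λ₅ : Finset (HiggsLattice.Site P j)) : Prop where
  /-- `ζ_{Λ₀^{(k−1)}}` sees `A′, φ′` outside `Λ₅` only. [cite: Balaban1982Higgs2, (2.46) p.567] -/
  zeta_loc : ∀ An φ A' φ', W.zeta An φ A' φ' = W.zeta An φ (cutTo Λ₅ᶜ A') (cutTo Λ₅ᶜ φ')
  /-- `χ_{Λ₋₁∩Λ₅ᶜ}` sees `A′, φ′` outside `Λ₅` only. [cite: Balaban1982Higgs2, (2.46) p.567] -/
  chi1_loc : ∀ An φ A' φ', W.chi1 An φ A' φ' = W.chi1 An φ (cutTo Λ₅ᶜ A') (cutTo Λ₅ᶜ φ')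
  /-- `χ_{k−1,Λ₅ᶜ}` sees `A′, φ′` outside `Λ₅` only. [cite: Balaban1982Higgs2, (2.46) p.567] -/
  chi2_loc : ∀ An φ A' φ', W.chi2 An φ A' φ' = W.chi2 An φ (cutTo Λ₅ᶜ A') (cutTo Λ₅ᶜ φ')
  /-- `ρ′^{(k−1)}` sees `A′, φ′` outside `Λ₅` only ((2.50) at step `k−1`). [cite: Balaban1982Higgs2, (2.50) p.568] -/
  rhoP_loc : ∀ A' φ', W.rhoP A' W.Atil' φ' = W.rhoP (cutTo Λ₅ᶜ A') W.Atil' (cutTo Λ₅ᶜ φ')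
  /-- `ζ ≥ 0`. [cite: Balaban1982Higgs2, (2.15) p.559] -/
  zeta_nonneg : ∀ An φ A' φ', 0 ≤ W.zeta An φ A' φ'
  /-- `χ ≥ 0`. [cite: Balaban1982Higgs2, (2.6) p.558] -/
  chi1_nonneg : ∀ An φ A' φ', 0 ≤ W.chi1 An φ A' φ'
  /-- `χ ≥ 0`. [cite: Balaban1982Higgs2, (2.6) p.558] -/
  chi2_nonneg : ∀ An φ A' φ', 0 ≤ W.chi2 An φ A' φ'
  /-- `ρ′ ≥ 0`. [cite: Balaban1982Higgs2, (2.49) p.568] -/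
  rhoP_nonneg : ∀ A' φ', 0 ≤ W.rhoP A' W.Atil' φ'
  /-- `ζ` jointly measurable in `(A′, φ′)`. [cite: Balaban1982Higgs2, (2.45) p.567] -/
  zeta_meas : ∀ An φ, Measurable fun q : ScalarField P j P.d × ScalarField P j N => W.zeta An φ q.1 q.2
  /-- `χ` jointly measurable in `(A′, φ′)`. [cite: Balaban1982Higgs2, (2.45) p.567] -/
  chi1_meas : ∀ An φ, Measurable fun q : ScalarField P j P.d × ScalarField P j N => W.chi1 An φ q.1 q.2
  /-- `χ` jointly measurable in `(A′, φ′)`. [cite: Balaban1982Higgs2, (2.45) p.567] -/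
  chi2_meas : ∀ An φ, Measurable fun q : ScalarField P j P.d × ScalarField P j N => W.chi2 An φ q.1 q.2
  /-- `ρ′` jointly measurable in `(A′, φ′)`. [cite: Balaban1982Higgs2, (2.45) p.567] -/
  rhoP_meas : Measurable fun q : ScalarField P j P.d × ScalarField P j N => W.rhoP q.1 W.Atil' q.2

variable {Q : B2.Params} {bad : (j : ℕ) → Set (HiggsLattice.Site P j)} {K : ℕ} {W : Weights P N (j + 1)}

/-- **`Data245.Hyp` FOR THE CONSTRUCTED DATA**: the nestings `Λ₅^{(k−1)} ⊂ Λ₃^{(k−1)}`, `Λ₅^{(k−1)} ⊂ Λ₄^{(k−1)}` ((2.8)′,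
`towerRegion_antitone`), `Λ₅^{(k−1)} ⊂ Λ₆^{(k−2)′}` (p. 566 *"Λ₀^{(j+1)} ⊂ Λ₇^{(j)′}"*, `towerRegion_succ_subset_prime_of_le`), and the
agreement `Ã = A^{(k),ε}` on the bonds under `Λ₅^{(k−1)} ⊂ Λ₂^{(k−1)}` (*"θ_k … is equal to 1 on B^{k−1}(Λ₂^{(k−1)})"*,
`B2Eq245KernelField.atil_thetaOf`) are THEOREMS for Bałaban's regions and cut-offs (`R, r ≥ 0`, `k = j + 2 ≤ K`); the analytic
clauses are those of `W`. [cite: Balaban1982Higgs2, (2.45)–(2.46) p.567] -/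
theorem hyp_dataOfTower (hR : 0 ≤ Q.R) (hr : 0 ≤ Q.r) (hjK : j + 2 ≤ K)
    (hW : W.Hyp (towerRegion bad (towerRad Q P) (j + 1) 5)) : (dataOfTower Q bad K j W).Hyp := by
  have hr0 : ∀ i, 0 ≤ towerRad Q P i := towerRad_nonneg hR hr P
  have hL5 : HiggsLattice.blockSet (dataOfTower Q bad K j W).L5 = towerRegion bad (towerRad Q P) (j + 1) 5 :=
    blockSet_dataOfTower_L5 Q bad K j W
  refine
    { L5_R3 := ?_, L5_R4 := ?_, L5_R6 := ?_, atil := ?_,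
      zeta_loc := ?_, chi1_loc := ?_, chi2_loc := ?_, rhoP_loc := ?_,
      zeta_nonneg := hW.zeta_nonneg, chi1_nonneg := hW.chi1_nonneg, chi2_nonneg := hW.chi2_nonneg,
      rhoP_nonneg := hW.rhoP_nonneg, zeta_meas := hW.zeta_meas, chi1_meas := hW.chi1_meas, chi2_meas := hW.chi2_meas,
      rhoP_meas := hW.rhoP_meas }
  · rw [hL5]
    exact towerRegion_antitone (hr0 (j + 1)) (by norm_num)
  · rw [hL5]
    exact towerRegion_antitone (hr0 (j + 1)) (by norm_num)
  · rw [hL5]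
    exact towerRegion_succ_subset_prime_of_le (hr0 j) (hr0 (j + 1)) 5 (by norm_num)
  · exact atil_thetaOf Q bad hjK (hL5 ▸ towerRegion_antitone (hr0 (j + 1)) (by norm_num)) W.Akm1 W.Ak
  · intro An φ A' φ'
    rw [hL5]
    exact hW.zeta_loc An φ A' φ'
  · intro An φ A' φ'
    rw [hL5]
    exact hW.chi1_loc An φ A' φ'
  · intro An φ A' φ'
    rw [hL5]
    exact hW.chi2_loc An φ A' φ'
  · intro A' φ'
    rw [hL5]
    exact hW.rhoP_loc A' φ'

end Hyp

/-! ## §4 (2.45) = (2.46) for Bałaban's regions and cut-offs -/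

section Main

variable {j : ℕ} (C : ChargeData N) {Q : B2.Params} {bad : (j : ℕ) → Set (HiggsLattice.Site P j)} {K : ℕ}
  {W : Weights P N (j + 1)}

/-- **(2.45) = (2.46) p. 567 FOR THE CONSTRUCTED TOWER** — *"Another representation is obtained by calculation of a conditional
integral in (2.45) with the conditioning on Λ₅^{(k−1)c}"* — at every step `k = j + 2 ≤ K` (and `k ≤` the lattice depth `P.K`), for the
regions `Λ_i^{(k−1)}`, `Λ₆^{(k−2)′}`, `B^{k−1}(Λ₂^{(k−1)})`, `B^{k−1}(Λ₂^{(k−2)′}∩Λ₅^{(k−1)c})` of `B2Eq243RegionsTower` built from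
any large-field data `bad`, the kernel field `Ã` at the cut-offs `B2Eq245Theta.thetaOf`, any external fields and any weights with
the analytic hypotheses `Weights.Hyp` relative to `Λ₅^{(k−1)}`; m² > 0, μ₀² > 0, a > 0, L > 1, `R, r ≥ 0`:
`B2Eq245Assembled.display245_eq_display246` with `Data245.Hyp` supplied by `hyp_dataOfTower`. [cite: Balaban1982Higgs2, (2.45)–(2.46) p.567] -/
theorem display245_eq_display246_tower {μ msq a : ℝ} (hmsq : 0 < msq) (hμ : 0 < μ) (ha : 0 < a) (hL : 1 < (P.L : ℝ))
    (hR : 0 ≤ Q.R) (hr : 0 ≤ Q.r) (hjK : j + 2 ≤ K) (hKP : j + 2 ≤ P.K)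
    (hW : W.Hyp (towerRegion bad (towerRad Q P) (j + 1) 5))
    (An : ScalarField P (j + 2) P.d) (φ : ScalarField P (j + 2) N) :
    display245 C μ msq a (dataOfTower Q bad K j W) An φ = display246 C μ msq a (dataOfTower Q bad K j W) An φ :=
  display245_eq_display246 C hmsq hμ ha hL hKP (hyp_dataOfTower hR hr hjK hW) An φ

end Main

/-! ## §5 Non-vacuity of the analytic hypotheses -/

section NonVacuity

variable {j : ℕ}

variable (P N j) in
/-- The weights with every characteristic function and `ρ′` identically `1` and the three field parameters given
(a witness for `Weights.Hyp`; print's characteristic functions take the values `0, 1`). [cite: Balaban1982Higgs2, (2.45) p.567] -/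
def Weights.const (Ak Akm1 Atil' : HiggsLattice.VecField P 0) : Weights P N j where
  Ak := Ak
  Akm1 := Akm1
  Atil' := Atil'
  chik := fun _ _ => 1
  zeta := fun _ _ _ _ => 1
  chi1 := fun _ _ _ _ => 1
  chi2 := fun _ _ _ _ => 1
  rhoP := fun _ _ _ => 1

/-- The constant weights satisfy the analytic hypotheses relative to ANY region. [cite: Balaban1982Higgs2, (2.45) p.567] -/
theorem Weights.const_hyp (Ak Akm1 Atil' : HiggsLattice.VecField P 0) (Λ₅ : Finset (HiggsLattice.Site P j)) :
    (Weights.const P N j Ak Akm1 Atil').Hyp Λ₅ where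
  zeta_loc _ _ _ _ := rfl
  chi1_loc _ _ _ _ := rfl
  chi2_loc _ _ _ _ := rfl
  rhoP_loc _ _ := rfl
  zeta_nonneg _ _ _ _ := zero_le_one
  chi1_nonneg _ _ _ _ := zero_le_one
  chi2_nonneg _ _ _ _ := zero_le_one
  rhoP_nonneg _ _ := zero_le_one
  zeta_meas _ _ := measurable_const
  chi1_meas _ _ := measurable_const
  chi2_meas _ _ := measurable_const
  rhoP_meas := measurable_const

/-- Hence the hypothesis bundle `Data245.Hyp` of the (2.45) = (2.46) theorem is INHABITED by constructed data at every step
`k = j + 2 ≤ K`, for every large-field data and every `R, r ≥ 0`. [cite: Balaban1982Higgs2, (2.45)–(2.46) p.567] -/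
theorem exists_hyp_dataOfTower (Q : B2.Params) (hR : 0 ≤ Q.R) (hr : 0 ≤ Q.r) (bad : (j : ℕ) → Set (HiggsLattice.Site P j))
    {K : ℕ} (hjK : j + 2 ≤ K) (Ak Akm1 Atil' : HiggsLattice.VecField P 0) :
    ∃ W : Weights P N (j + 1), (dataOfTower Q bad K j W).Hyp :=
  ⟨Weights.const P N (j + 1) Ak Akm1 Atil', hyp_dataOfTower hR hr hjK (Weights.const_hyp Ak Akm1 Atil' _)⟩

end NonVacuity

end Literature.MathematicalPhysics.QuantumFieldTheory.Balaban1983to89.B2Eq245TowerData
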